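import Literature.Geometry.Manifold.CircleSubmersionConnectedFibres
import Literature.Geometry.Manifold.CoveringSpaceManifold
import HarnessLib

/-!
# Equivariant functions on the infinite cyclic cover descend to circle-valued maps

The last step of fibration theorems over the circle proved on a `ℤ`-cover (H. Huang,
X.-T. Huang, J. Wang, X. Zhu, arXiv:2605.24380 (2026), §4, p. 14: the `Kᵢ`-equivariant smooth
maps `Fᵢ` on the covers "descend to the quotient space … `F̂ᵢ : Mᵢ → Tˢ/Kᵢ'`", and "`dFᵢ` is
non-degenerate" makes them fibrations; here `b = s = 1`, the cover is the infinite cyclic cover and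
the torus is the circle `ℝ/2πℤ`). For the infinite cyclic cover `X̂ = CircleMaps.CyclicCover f`
of a space `X` along `f : X → S¹` (`InfiniteCyclicCover.lean`: projection `proj`, level function
`level`, deck action `k +ᵥ (x, s) = (x, s + 2πk)`) and a function `F : X̂ → ℝ` which is
**equivariant**, `F (k +ᵥ x̂) = F x̂ + 2πk`:

* `descendCircle f F : X → 𝕊¹` — **the descended circle map**, `x ↦ (cos F(x̂), sin F(x̂))` for
  any `x̂` over `x` (`descendCircle_proj`: well defined by equivariance; the unit circle `𝕊¹` of
  `EuclideanSpace ℝ (Fin 2)` with the tree's `circlePoint`), characterised by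
  `descendCircle ∘ proj = circlePoint ∘ F` (`eq_descendCircle_of_comp_proj`); descending the
  level function recovers `f` (`toCircle_descendCircle_level`);
* `continuous_descendCircle` — it is continuous when `F` is (`proj` is a quotient map);
* `contMDiff_descendCircle` — on a `C^∞` manifold `X` it is `C^n` when `F` is (`proj` is a local
  diffeomorphism, `CoveringSpaceManifold.lean`, Lee 2012, Prop. 4.40);
* `surjective_mfderiv_descendCircle_iff` — **it is a submersion at `proj x̂` iff `dF_{x̂} ≠ 0`**
  (chain rule through the local diffeomorphism `proj` and `surjective_mfderiv_circlePoint_comp_iff`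
  of `CircleSubmersionConnectedFibres.lean`); hence an equivariant `F` without critical points
  descends to a smooth submersion `X → 𝕊¹` (`exists_submersion_of_equivariant`).

Everything is proved; the only definition is the construction `descendCircle`; no named facts.

## References

* H. Huang, X.-T. Huang, J. Wang, X. Zhu, *Fibrations, the first Betti number, and almost
  nonnegative Ricci curvature*, arXiv:2605.24380 (2026), §4, p. 14. [HuangHuangWangZhu2026]
* A. Hatcher, *Algebraic Topology*, CUP (2002), §1.3, Prop. 1.39–1.40 (deck transformations,
  quotients by covering space actions). [HatcherAT2002]
* J. M. Lee, *Introduction to Smooth Manifolds*, 2nd ed. (2012), Prop. 4.40, Thm. 4.29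
  (smooth covering maps are local diffeomorphisms; characteristic property of surjective
  submersions). [LeeSmoothManifolds2013]
-/

noncomputable section

open scoped Manifold ContDiff Topology Real
open Function Set Filter

namespace Literature.Geometry.Manifold

open Literature.Topology.FourManifolds Literature.Topology.FourManifolds.CircleMaps
  Literature.Topology.FourManifolds.CircleMaps.CyclicCover

/-- Local notation: the unit circle in `EuclideanSpace ℝ (Fin 2)` (the tree's `𝕊 1`). -/
local notation "𝕊¹" => (Metric.sphere (0 : EuclideanSpace ℝ (Fin 2)) 1)

/-! ### The descended map (topology) -/

section Topology

variable {X : Type*} [TopologicalSpace X] (f : C(X, Circle))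

/-- **The circle map descended from an equivariant function on the cyclic cover**:
`descendCircle f F x = (cos F(x̂), sin F(x̂))` for the base point `x̂ = base f x` over `x`; for an
equivariant `F` any point over `x` gives the same value (`descendCircle_proj`). (Huang–Huang–
Wang–Zhu 2026, §4, p. 14: equivariant maps on the cover "descend to the quotient space".)
[cite: HuangHuangWangZhu2026, §4 p. 14] -/
def descendCircle (F : CyclicCover f → ℝ) (x : X) : 𝕊¹ :=
  circlePoint (F (base f x))

variable {f} {F : CyclicCover f → ℝ}

/-- **Well-definedness**: for an equivariant `F`, `descendCircle f F (proj x̂) = circlePoint (F x̂)`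
for EVERY `x̂` (two points over `proj x̂` differ by a deck translation, which changes `F` by a
multiple of `2π`). [cite: HatcherAT2002, §1.3 Prop. 1.39] -/
theorem descendCircle_proj (hF : ∀ (k : ℤ) (x : CyclicCover f), F (k +ᵥ x) = F x + k * (2 * π))
    (x : CyclicCover f) : descendCircle f F (proj x) = circlePoint (F x) := by
  obtain ⟨k, hk⟩ := exists_vadd_eq_of_proj_eq (proj_base (f := f) (proj x))
  show circlePoint (F (base f (proj x))) = circlePoint (F x)
  rw [← hk, hF, (periodic_circlePoint.int_mul k) (F x)]

/-- `descendCircle f F ∘ proj = circlePoint ∘ F`. [folklore] -/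
theorem descendCircle_comp_proj
    (hF : ∀ (k : ℤ) (x : CyclicCover f), F (k +ᵥ x) = F x + k * (2 * π)) :
    descendCircle f F ∘ proj = circlePoint ∘ F :=
  funext (descendCircle_proj hF)

/-- In Mathlib's `Circle`: `toCircle (descendCircle f F (proj x̂)) = exp (F x̂)`. [folklore] -/
theorem toCircle_descendCircle_proj
    (hF : ∀ (k : ℤ) (x : CyclicCover f), F (k +ᵥ x) = F x + k * (2 * π))
    (x : CyclicCover f) : toCircle (descendCircle f F (proj x)) = Circle.exp (F x) := by
  rw [descendCircle_proj hF, toCircle_circlePoint]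

/-- **Uniqueness**: a map `G : X → 𝕊¹` with `G ∘ proj = circlePoint ∘ F` is the descended map
(`proj` is onto). [folklore] -/
theorem eq_descendCircle_of_comp_proj
    (hF : ∀ (k : ℤ) (x : CyclicCover f), F (k +ᵥ x) = F x + k * (2 * π)) {G : X → 𝕊¹}
    (hG : ∀ x : CyclicCover f, G (proj x) = circlePoint (F x)) : G = descendCircle f F := by
  funext y
  obtain ⟨x, rfl⟩ := proj_surjective (f := f) y
  rw [hG, descendCircle_proj hF]

/-- **Descending the level function recovers `f`**: `toCircle ∘ descendCircle f level = f`
(`f (proj x̂) = exp (level x̂)`). [folklore] -/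
theorem toCircle_descendCircle_level (y : X) :
    toCircle (descendCircle f level y) = f y := by
  obtain ⟨x, rfl⟩ := proj_surjective (f := f) y
  rw [toCircle_descendCircle_proj (fun k x ↦ level_vadd k x), apply_proj]

/-- **The descended map is continuous** when `F` is (`proj` is a quotient map and
`descendCircle f F ∘ proj = circlePoint ∘ F` is continuous). [cite: HatcherAT2002, §1.3 Prop. 1.40] -/
theorem continuous_descendCircle
    (hF : ∀ (k : ℤ) (x : CyclicCover f), F (k +ᵥ x) = F x + k * (2 * π)) (hFc : Continuous F) :
    Continuous (descendCircle f F) := by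
  rw [(isQuotientMap_proj (f := f)).continuous_iff, descendCircle_comp_proj hF]
  exact continuous_circlePoint.comp hFc

end Topology

/-! ### Smoothness and the submersion criterion -/

section Smooth

variable {E : Type*} [NormedAddCommGroup E] [NormedSpace ℝ E]
  {H : Type*} [TopologicalSpace H] {I : ModelWithCorners ℝ E H}
  {X : Type*} [TopologicalSpace X] [ChartedSpace H X]
  (f : C(X, Circle)) {F : CyclicCover f → ℝ} {n : ℕ∞}

/-- **The descended map is `C^n` where `F` is** (`n ≤ ∞`): near `proj x̂`,
`descendCircle f F = circlePoint ∘ F ∘ σ` for the local inverse `σ` of the local diffeomorphism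
`proj` at `x̂` (Lee 2012, Prop. 4.40 / Thm. 4.29). [cite: LeeSmoothManifolds2013, Prop. 4.40] -/
theorem contMDiffAt_descendCircle [IsManifold I n X]
    (hF : ∀ (k : ℤ) (x : CyclicCover f), F (k +ᵥ x) = F x + k * (2 * π)) {x : CyclicCover f}
    (hFs : ContMDiffAt I 𝓘(ℝ, ℝ) n F x) :
    ContMDiffAt I (𝓡 1) n (descendCircle f F) (proj x) := by
  have hl : IsLocalDiffeomorphAt I I n (proj : CyclicCover f → X) x :=
    isLocalDiffeomorph_cyclicCover_proj f x
  set e := hl.localInverse with he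
  have hex : e (proj x) = x := hl.localInverse_left_inv hl.localInverse_mem_target
  have hFs' : ContMDiffAt I 𝓘(ℝ, ℝ) n F (e (proj x)) := by
    rw [hex]
    exact hFs
  have hcp : ContMDiff 𝓘(ℝ, ℝ) (𝓡 1) n circlePoint :=
    contMDiff_circlePoint.of_le (by exact_mod_cast le_top)
  have h1 : ContMDiffAt I (𝓡 1) n (circlePoint ∘ F ∘ e) (proj x) :=
    hcp.contMDiffAt.comp _ (hFs'.comp _ hl.localInverse_contMDiffAt)
  refine h1.congr_of_eventuallyEq ?_
  filter_upwards [e.open_source.mem_nhds hl.localInverse_mem_source] with y hy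
  show descendCircle f F y = circlePoint (F (e y))
  rw [← descendCircle_proj hF (e y), hl.localInverse_right_inv hy]

/-- **The descended map of a `C^n` equivariant function is `C^n`** (`n ≤ ∞`).
[cite: LeeSmoothManifolds2013, Prop. 4.40 and Thm. 4.29] -/
theorem contMDiff_descendCircle [IsManifold I n X]
    (hF : ∀ (k : ℤ) (x : CyclicCover f), F (k +ᵥ x) = F x + k * (2 * π))
    (hFs : ContMDiff I 𝓘(ℝ, ℝ) n F) : ContMDiff I (𝓡 1) n (descendCircle f F) := fun y ↦ by
  obtain ⟨x, rfl⟩ := proj_surjective (f := f) y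
  exact contMDiffAt_descendCircle f hF (hFs x)

/-- **Submersion criterion**: for a `C^n` equivariant `F`, `n ≥ 1`, the descended map is a
submersion at `proj x̂` (its differential is onto the tangent line of the circle) iff
`dF_{x̂} ≠ 0` — the chain rule for `descendCircle f F ∘ proj = circlePoint ∘ F` through the
bijective differential of `proj`, and `circlePoint ∘ F` is a submersion exactly where `dF ≠ 0`
(`surjective_mfderiv_circlePoint_comp_iff`). In Huang–Huang–Wang–Zhu 2026, §4, p. 14, this is
"`dFᵢ` is non-degenerate. Hence `Fᵢ` is a smooth fibration … descends to the quotient".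
[cite: HuangHuangWangZhu2026, §4 p. 14] -/
theorem surjective_mfderiv_descendCircle_iff [IsManifold I n X] (hn : n ≠ 0)
    (hF : ∀ (k : ℤ) (x : CyclicCover f), F (k +ᵥ x) = F x + k * (2 * π)) {x : CyclicCover f}
    (hFs : ContMDiffAt I 𝓘(ℝ, ℝ) n F x) :
    Surjective (mfderiv I (𝓡 1) (descendCircle f F) (proj x)) ↔ mfderiv I 𝓘(ℝ, ℝ) F x ≠ 0 := by
  have hn' : (n : ℕ∞ω) ≠ 0 := by exact_mod_cast hn
  have hd : MDifferentiableAt I (𝓡 1) (descendCircle f F) (proj x) :=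
    (contMDiffAt_descendCircle f hF hFs).mdifferentiableAt hn'
  have hp : MDifferentiableAt I I (proj : CyclicCover f → X) x :=
    (contMDiff_cyclicCover_proj f (I := I) (n := n) x).mdifferentiableAt hn'
  have hFd : MDifferentiableAt I 𝓘(ℝ, ℝ) F x := hFs.mdifferentiableAt hn'
  have hcomp : mfderiv I (𝓡 1) (circlePoint ∘ F) x =
      (mfderiv I (𝓡 1) (descendCircle f F) (proj x)).comp
        (mfderiv I I (proj : CyclicCover f → X) x) := by
    rw [← descendCircle_comp_proj hF]
    exact mfderiv_comp x hd hp
  have hbij := bijective_mfderiv_cyclicCover_proj f (I := I) hn' x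
  have hfun : ∀ v : TangentSpace I x,
      (mfderiv I (𝓡 1) (circlePoint ∘ F) x v : EuclideanSpace ℝ (Fin 1)) =
        mfderiv I (𝓡 1) (descendCircle f F) (proj x)
          (mfderiv I I (proj : CyclicCover f → X) x v) := fun v ↦ by
    rw [hcomp]
    rfl
  rw [← surjective_mfderiv_circlePoint_comp_iff hFd]
  constructor
  · intro hD w
    obtain ⟨u, hu⟩ := hD w
    obtain ⟨v, hv⟩ := hbij.2 u
    refine ⟨v, ?_⟩
    rw [hfun, hv]
    exact hu
  · intro hC w
    obtain ⟨v, hv⟩ := hC w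
    refine ⟨mfderiv I I (proj : CyclicCover f → X) x v, ?_⟩
    rw [← hfun]
    exact hv

/-- **An equivariant function without critical points descends to a smooth submersion onto the
circle**: if `F : X̂ → ℝ` is `C^n` (`1 ≤ n ≤ ∞`), equivariant and `dF ≠ 0` everywhere, then
`descendCircle f F : X → 𝕊¹` is `C^n` with surjective differential everywhere, and
`descendCircle f F ∘ proj = circlePoint ∘ F` (Huang–Huang–Wang–Zhu 2026, §4, p. 14, the case
`b = 1`). [cite: HuangHuangWangZhu2026, §4 p. 14] -/
theorem exists_submersion_of_equivariant [IsManifold I n X] (hn : n ≠ 0)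
    (hF : ∀ (k : ℤ) (x : CyclicCover f), F (k +ᵥ x) = F x + k * (2 * π))
    (hFs : ContMDiff I 𝓘(ℝ, ℝ) n F) (hdF : ∀ x, mfderiv I 𝓘(ℝ, ℝ) F x ≠ 0) :
    ∃ G : X → 𝕊¹, ContMDiff I (𝓡 1) n G ∧ (∀ y, Surjective (mfderiv I (𝓡 1) G y)) ∧
      ∀ x : CyclicCover f, G (proj x) = circlePoint (F x) := by
  refine ⟨descendCircle f F, contMDiff_descendCircle f hF hFs, fun y ↦ ?_, descendCircle_proj hF⟩
  obtain ⟨x, rfl⟩ := proj_surjective (f := f) y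
  exact (surjective_mfderiv_descendCircle_iff f hn hF (hFs x)).2 (hdF x)

end Smooth

end Literature.Geometry.Manifold
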